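import Mathlib.RingTheory.GradedAlgebra.HomogeneousLocalization
import Mathlib.RingTheory.MvPolynomial.Homogeneous
import Mathlib.RingTheory.Localization.Away.Basic

/-!
# T6A2ProjChart — the standard affine chart of projective space

Cell pub-hodge-repro2, Tier 6 (README §10), seat t6-p2 (A2 owner; gen 12, custodial). Piece (W-b) of the
non-vacuity record for DATA row 12 (`surf : Choice → SurfaceDatum C`, README §10.5(ii)(c)): for the standard
grading `𝒜 = homogeneousSubmodule σ R` on `R[Xⱼ : j ∈ σ]` and a variable `Xᵢ`, the degree-zero localisation
`(R[X]_{Xᵢ})₀ = HomogeneousLocalization.Away 𝒜 (X i)` — the coordinate ring of the chart `D₊(Xᵢ) ⊂ Proj` — is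
the polynomial ring in the coordinates `Xⱼ / Xᵢ`, `j ≠ i`:
`chartEquiv R i : MvPolynomial {j // j ≠ i} R ≃+* Away 𝒜 (X i)`, compatible with the structure maps from `R`
(`chartEquiv_comp_algebraMap`). Mathlib only; no display; no `sorry`; standard axioms.
§8(d): uses an L-value-free non-vanishing device: NO.
Filed in Tier-6 WAVE 1 (2026-08-26) as p437576 (definition lane, ACCEPTED 10:23Z, commit 60ffc0546676); this v2 differs from the filed bytes in this module docstring only (the staged-record wording dropped).
-/

namespace Summit.Ventures.HodgeRepro2.T6.A2Surface

open MvPolynomial HomogeneousLocalization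

attribute [local instance] MvPolynomial.gradedAlgebra

universe u v

variable (R : Type u) [CommRing R] {σ : Type v} (i : σ)

/-- `X i` is homogeneous of degree `1`. -/
theorem X_mem_homogeneousSubmodule_one (j : σ) : X j ∈ homogeneousSubmodule σ R 1 :=
  isHomogeneous_X R j

/-- the coordinate `Xⱼ / Xᵢ` of the chart `D₊(Xᵢ)` -/
noncomputable def chartCoord (j : σ) : Away (homogeneousSubmodule σ R) (X i) :=
  Away.mk _ (X_mem_homogeneousSubmodule_one R i) 1 (X j) (by simpa using isHomogeneous_X R j)

/-- the value of `Xⱼ / Xᵢ` in the ordinary localisation -/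
theorem val_chartCoord (j : σ) :
    (chartCoord R i j).val = Localization.mk (X j) ⟨X i, Submonoid.mem_powers _⟩ := by
  change Localization.mk (X j) ⟨X i ^ 1, by use 1⟩ = _
  exact congrArg _ (Subtype.ext (pow_one _))

/-- `Xᵢ / Xᵢ = 1` -/
theorem chartCoord_self : chartCoord R i i = 1 := by
  apply HomogeneousLocalization.val_injective
  rw [val_chartCoord, val_one]
  exact Localization.mk_self_mk _ _

/-- the structure map `R → (R[X]_{Xᵢ})₀`, through `R = 𝒜 0` -/
noncomputable def chartAlgebraMap : R →+* Away (homogeneousSubmodule σ R) (X i) :=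
  (fromZeroRingHom (homogeneousSubmodule σ R) (Submonoid.powers (X i))).comp
    (algebraMap R (homogeneousSubmodule σ R 0))

/-- the value of the structure map in the ordinary localisation -/
theorem val_chartAlgebraMap (r : R) :
    (chartAlgebraMap R i r).val = algebraMap (MvPolynomial σ R) _ (C r) := by
  change (fromZeroRingHom _ _ _).val = _
  rw [fromZeroRingHom, RingHom.coe_mk, MonoidHom.coe_mk, OneHom.coe_mk, val_mk,
    ← Localization.mk_one_eq_algebraMap]
  rfl

/-- the ring map `R[Xⱼ : j ∈ σ] → (R[X]_{Xᵢ})₀`, `Xⱼ ↦ Xⱼ / Xᵢ` -/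
noncomputable def toChart : MvPolynomial σ R →+* Away (homogeneousSubmodule σ R) (X i) :=
  eval₂Hom (chartAlgebraMap R i) (chartCoord R i)

/-- `toChart` sends a constant `C r` to the structure-map image of `r`. -/
@[simp] theorem toChart_C (r : R) : toChart R i (C r) = chartAlgebraMap R i r := by
  simp [toChart]

/-- `toChart` sends the variable `Xⱼ` to the chart coordinate `Xⱼ / Xᵢ`. -/
@[simp] theorem toChart_X (j : σ) : toChart R i (X j) = chartCoord R i j := by
  simp [toChart]

/-- the composite with the value map, as a ring map into the ordinary localisation -/
noncomputable def toChartLoc : MvPolynomial σ R →+* Localization.Away (X i : MvPolynomial σ R) :=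
  (algebraMap (Away (homogeneousSubmodule σ R) (X i)) (Localization.Away (X i))).comp (toChart R i)

/-- `toChartLoc` is `toChart` followed by the value map, pointwise. -/
theorem toChartLoc_apply (p : MvPolynomial σ R) : toChartLoc R i p = (toChart R i p).val := rfl

/-- `(Xⱼ / Xᵢ) · Xᵢ = Xⱼ` in the localisation -/
theorem toChartLoc_X_mul (j : σ) :
    toChartLoc R i (X j) * algebraMap (MvPolynomial σ R) _ (X i) =
      algebraMap (MvPolynomial σ R) (Localization.Away (X i : MvPolynomial σ R)) (X j) := by
  rw [toChartLoc_apply, toChart_X, val_chartCoord, Localization.mk_eq_mk'_apply]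
  exact IsLocalization.mk'_spec _ _ _

/-- a monomial of degree `n` is sent to `m / Xᵢⁿ`: `toChartLoc (m) · Xᵢⁿ = m` -/
theorem toChartLoc_monomial_mul_pow (d : σ →₀ ℕ) (r : R) :
    toChartLoc R i (monomial d r) * algebraMap (MvPolynomial σ R) _ (X i ^ d.degree) =
      algebraMap (MvPolynomial σ R) (Localization.Away (X i : MvPolynomial σ R)) (monomial d r) := by
  have h1 : ∀ (j : σ) (e : ℕ), toChartLoc R i (X j ^ e) *
      algebraMap (MvPolynomial σ R) (Localization.Away (X i : MvPolynomial σ R)) (X i ^ e) =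
      algebraMap (MvPolynomial σ R) (Localization.Away (X i : MvPolynomial σ R)) (X j ^ e) := by
    intro j e
    rw [map_pow, map_pow, map_pow, ← mul_pow, toChartLoc_X_mul]
  rw [monomial_eq, Finsupp.prod, Finsupp.degree_apply, ← Finset.prod_pow_eq_pow_sum]
  simp only [map_mul, map_prod]
  rw [mul_assoc, ← Finset.prod_mul_distrib]
  congr 1
  · rw [toChartLoc_apply, toChart_C, val_chartAlgebraMap]
  · exact Finset.prod_congr rfl fun j _ => h1 j (d j)

/-- a homogeneous polynomial of degree `n` is sent to `p / Xᵢⁿ`: `toChartLoc p · Xᵢⁿ = p` -/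
theorem toChartLoc_mul_pow {p : MvPolynomial σ R} {n : ℕ} (hp : p.IsHomogeneous n) :
    toChartLoc R i p * algebraMap (MvPolynomial σ R) _ (X i ^ n) =
      algebraMap (MvPolynomial σ R) (Localization.Away (X i : MvPolynomial σ R)) p := by
  conv_lhs => rw [p.as_sum]
  conv_rhs => rw [p.as_sum]
  rw [map_sum, map_sum, Finset.sum_mul]
  refine Finset.sum_congr rfl fun d hd => ?_
  have hd' : d.degree = n := by
    rw [Finsupp.degree_eq_weight_one]
    exact hp (mem_support_iff.mp hd)
  rw [← hd']
  exact toChartLoc_monomial_mul_pow R i d _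

/-- `toChart` hits `p / Xᵢⁿ` for `p` homogeneous of degree `n` -/
theorem toChart_eq_mk {p : MvPolynomial σ R} {n : ℕ} (hp : p ∈ homogeneousSubmodule σ R (n • 1)) :
    toChart R i p = Away.mk _ (X_mem_homogeneousSubmodule_one R i) n p hp := by
  apply HomogeneousLocalization.val_injective
  rw [Away.val_mk, Localization.mk_eq_mk'_apply, IsLocalization.eq_mk'_iff_mul_eq]
  exact toChartLoc_mul_pow R i (by simpa using hp)

/-- `toChart` is surjective -/
theorem toChart_surjective : Function.Surjective (toChart R i) := fun z => by
  obtain ⟨n, p, hp, rfl⟩ := Away.mk_surjective _ (X_mem_homogeneousSubmodule_one R i) z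
  exact ⟨p, toChart_eq_mk R i hp⟩

section Equiv

variable [DecidableEq σ]

/-- the coordinate substitution `Xᵢ ↦ 1`, `Xⱼ ↦ Xⱼ` (`j ≠ i`): `R[X] → R[Xⱼ : j ≠ i]` -/
noncomputable def killCoord : MvPolynomial σ R →ₐ[R] MvPolynomial {j // j ≠ i} R :=
  aeval fun j => if h : j = i then 1 else X ⟨j, h⟩

/-- `killCoord` sends `Xᵢ` to `1`. -/
@[simp] theorem killCoord_X_self : killCoord R i (X i) = 1 := by
  simp [killCoord]

/-- `killCoord` sends `Xⱼ`, `j ≠ i`, to the variable `Xⱼ` of the smaller polynomial ring. -/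
theorem killCoord_X_of_ne {j : σ} (h : j ≠ i) : killCoord R i (X j) = X ⟨j, h⟩ := by
  simp [killCoord, h]

/-- `killCoord` fixes the variables indexed by `{j // j ≠ i}`. -/
@[simp] theorem killCoord_X_val (j : {j // j ≠ i}) : killCoord R i (X j) = X j := by
  rw [killCoord_X_of_ne R i j.2]

/-- `killCoord` fixes constants. -/
@[simp] theorem killCoord_C (r : R) : killCoord R i (C r) = C r := by
  simp [killCoord]

/-- the chart ring map on the polynomial ring in the coordinates `Xⱼ / Xᵢ`, `j ≠ i` -/
noncomputable def toChart' : MvPolynomial {j // j ≠ i} R →+* Away (homogeneousSubmodule σ R) (X i) :=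
  (toChart R i).comp (rename (Subtype.val : {j // j ≠ i} → σ)).toRingHom

omit [DecidableEq σ] in
/-- `toChart'` sends `Xⱼ` (`j ≠ i`) to the chart coordinate `Xⱼ / Xᵢ`. -/
@[simp] theorem toChart'_X (j : {j // j ≠ i}) : toChart' R i (X j) = chartCoord R i j := by
  simp [toChart']

omit [DecidableEq σ] in
/-- `toChart'` sends a constant `C r` to the structure-map image of `r`. -/
@[simp] theorem toChart'_C (r : R) : toChart' R i (C r) = chartAlgebraMap R i r := by
  simp [toChart']

/-- `toChart = toChart' ∘ killCoord` -/
theorem toChart'_comp_killCoord :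
    (toChart' R i).comp (killCoord R i).toRingHom = toChart R i := by
  apply MvPolynomial.ringHom_ext
  · intro r
    simp
  · intro j
    by_cases h : j = i
    · subst h
      simp [chartCoord_self]
    · simp [killCoord_X_of_ne R i h]

/-- pointwise form of `toChart'_comp_killCoord` -/
theorem toChart'_killCoord (p : MvPolynomial σ R) :
    toChart' R i (killCoord R i p) = toChart R i p :=
  DFunLike.congr_fun (toChart'_comp_killCoord R i) p

/-- `toChart'` is surjective -/
theorem toChart'_surjective : Function.Surjective (toChart' R i) := fun z => by
  obtain ⟨p, rfl⟩ := toChart_surjective R i z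
  exact ⟨killCoord R i p, toChart'_killCoord R i p⟩

/-- `killCoord (X i) = 1` is a unit -/
theorem isUnit_killCoord_X : IsUnit ((killCoord R i).toRingHom (X i)) := by
  rw [AlgHom.toRingHom_eq_coe, RingHom.coe_coe, killCoord_X_self]
  exact isUnit_one

/-- the retraction `(R[X]_{Xᵢ})₀ → R[Xⱼ : j ≠ i]`, `Xⱼ / Xᵢ ↦ Xⱼ` -/
noncomputable def chartRetraction :
    Away (homogeneousSubmodule σ R) (X i) →+* MvPolynomial {j // j ≠ i} R :=
  (IsLocalization.Away.lift (X i : MvPolynomial σ R) (isUnit_killCoord_X R i)).comp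
    (algebraMap (Away (homogeneousSubmodule σ R) (X i)) (Localization.Away (X i : MvPolynomial σ R)))

/-- `chartRetraction` unfolded: the localisation lift applied to the value -/
theorem chartRetraction_apply (z : Away (homogeneousSubmodule σ R) (X i)) :
    chartRetraction R i z =
      IsLocalization.Away.lift (X i : MvPolynomial σ R) (isUnit_killCoord_X R i) z.val := rfl

/-- the retraction sends the chart coordinate `Xⱼ / Xᵢ` back to `Xⱼ` -/
theorem chartRetraction_toChart'_X (j : {j // j ≠ i}) :
    chartRetraction R i (toChart' R i (X j)) = X j := by
  have h := congrArg (IsLocalization.Away.lift (X i : MvPolynomial σ R) (isUnit_killCoord_X R i))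
    (toChartLoc_X_mul R i j)
  have e1 : (killCoord R i).toRingHom (X i) = 1 := killCoord_X_self R i
  have e2 : (killCoord R i).toRingHom (X (j : σ)) = X j := killCoord_X_val R i j
  rw [map_mul, IsLocalization.Away.lift_eq, IsLocalization.Away.lift_eq, e1, mul_one, e2,
    toChartLoc_apply, toChart_X] at h
  rw [chartRetraction_apply, toChart'_X]
  exact h

/-- the retraction sends the structure-map image of `r` back to `C r` -/
theorem chartRetraction_toChart'_C (r : R) :
    chartRetraction R i (toChart' R i (C r)) = C r := by
  rw [chartRetraction_apply, toChart'_C, val_chartAlgebraMap, IsLocalization.Away.lift_eq]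
  exact killCoord_C R i r

/-- the retraction inverts `toChart'` from the left -/
theorem chartRetraction_comp_toChart' :
    (chartRetraction R i).comp (toChart' R i) = RingHom.id _ := by
  apply MvPolynomial.ringHom_ext
  · intro r
    rw [RingHom.comp_apply, chartRetraction_toChart'_C, RingHom.id_apply]
  · intro j
    rw [RingHom.comp_apply, chartRetraction_toChart'_X, RingHom.id_apply]

/-- `toChart'` is injective -/
theorem toChart'_injective : Function.Injective (toChart' R i) := by
  intro p q h
  have := DFunLike.congr_fun (chartRetraction_comp_toChart' R i)
  simp only [RingHom.comp_apply, RingHom.id_apply] at this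
  rw [← this p, ← this q, h]

/-- THE CHART IDENTIFICATION: the coordinate ring of `D₊(Xᵢ) ⊂ Proj R[X]` is the polynomial ring in the
`Xⱼ / Xᵢ`, `j ≠ i`. -/
noncomputable def chartEquiv :
    MvPolynomial {j // j ≠ i} R ≃+* Away (homogeneousSubmodule σ R) (X i) :=
  RingEquiv.ofBijective (toChart' R i) ⟨toChart'_injective R i, toChart'_surjective R i⟩

/-- `chartEquiv` acts as `toChart'`. -/
@[simp] theorem chartEquiv_apply (p : MvPolynomial {j // j ≠ i} R) :
    chartEquiv R i p = toChart' R i p := rfl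

/-- the chart identification is compatible with the structure maps from `R` -/
theorem chartEquiv_comp_algebraMap :
    (chartEquiv R i).toRingHom.comp (algebraMap R (MvPolynomial {j // j ≠ i} R)) =
      chartAlgebraMap R i := by
  ext r
  simp

end Equiv

end Summit.Ventures.HodgeRepro2.T6.A2Surface
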